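import Literature.AnabelianGeometry.EtaleTheta.Discharge.Sec4BaseEquivOfTemperoids
import Literature.AnabelianGeometry.EtaleTheta.Discharge.Sec2Prop24CharacteristicY
import Literature.AnabelianGeometry.EtaleTheta.Discharge.Sec5OfThetaSetting
import Literature.AnabelianGeometry.EtaleTheta.Discharge.Sec5Prop51Thm44Pin
import Literature.AnabelianGeometry.SemiGraphs.ConnectedPartEquivExtension
import Literature.AnabelianGeometry.SemiGraphs.BTempQuotientProofs
import Literature.AnabelianGeometry.SemiGraphs.CosetCategoriesSlimTempered
import Literature.AlgebraicGeometry.Frobenioids.EquivalencePreStepsFSMFF2008Assembly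

/-!
# [EtTh] §5 p.322–323: "`A_⊚^bs` is *characteristic* — preserved by arbitrary self-equivalences of `D`" —
# the §4-setting binder `hchar` PRODUCED at the temperoid base from "`H_⊙ ⊆ Π^tp_X` is topologically characteristic"

S. Mochizuki, *The étale theta function and its Frobenioid-theoretic manifestations*, Publ. RIMS **45** (2009)
[MochizukiEtTh2009], §5 p.322–323 (PDF pp.96–97): «we take the object `A_⊚` of the theory of §4 to be the
[Frobenius-trivial] object defined by the trivial line bundle over … `Ÿ` … Observe that this `A_⊚^bs` is
"characteristic" — that is to say, it is preserved by arbitrary self-equivalences of `D` [cf. Propositions 2.4,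
2.6] — hence, in particular, Galois»; Thm. 4.4 p.319 (PDF p.93): «`Ψ^bs : D₁ ⥲ D₂` that maps `A_{⊙,1}^bs` to an
isomorph of `A_{⊙,2}^bs`».  S. Mochizuki, *Semi-graphs of anabelioids*, Publ. RIMS **42** (2006)
[MochizukiSemiAnbd2006], Prop. 3.2 p.35 (self-equivalences of `B^temp(Π)` are `B^temp(φ)`, `φ` an isomorphism),
Rmk. 3.1.3 p.34 (Galois objects are the `Π/N`), Rmk. 3.1.5 p.34 (`T⁰ ⊆ T`).

abc-iut cell, layer L2, ROW «hchar PRODUCER» (abc-iut-L2-lead gen 4 ROWS #14b R251, offer (c) of abc-iut-L2-t9 gen 3;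
seat abc-iut-w4-d008 gen 5).  PROOF-ONLY (no definition); nothing landed is edited or restated.

THE BINDER.  abc-iut-L2-t9's `BiKummerSetting.exists_thm44Hyp_self_of_characteristic` /
`exists_thm44Hyp_mkOfModelCanonical_treeCatVocab` (`Discharge/Sec5Prop51Thm44Pin.lean`) carry print's sentence as
`hchar : ∀ Θ : D ≌ D, IsIsomorph (Θ.functor.obj (S.base.obj S.Aodot)) (S.base.obj S.Aodot)` — "an anabelian input,
NOT proved here".  At print's base `D := B^temp(Π^tp_X)⁰ = ConnectedPart (BTemp X.Pi)` (abc-iut-L2-t4's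
`mkOfConnectedTemperoid`, `…Quot`, `…Ydd`, `mkOfThetaSettingYdd`) this file PROVES it from the group-theoretic
sentence print points to ("[cf. Propositions 2.4, 2.6]"): **`H_⊙ = Ker(Π^tp_X ↠ Aut(A_⊙^bs))` is characteristic in
the topological group `Π^tp_X`** (`EtaleTheta.IsTopCharacteristic`, abc-iut-w4-d034 / abc-iut-L2-t2's [EtTh]
Prop. 2.4 currency; for `A_⊙^bs := Ÿ̲̲` of the Setting it is literally "every topological automorphism of `Π^tp_X̲̲`
stabilises `Π^tp_Ÿ̲̲`" = abc-iut-L6-t1's (H1) `PiYddCharacteristic`, a HYPOTHESIS BY NAME, not a new Prop fact).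

ROUTE (every input a theorem of the tree, consumed BY NAME):
* `GaloisObjects.nonempty_iso_of_ker_galoisSurjOf_eq` — two Galois objects of `B^temp(Π)` with the same kernel
  `N = Ker(Π ↠ Aut(−))` are isomorphic (both are `Π/N`, abc-iut-L3's `BTemp.nonempty_quotientObj_iso`);
* `GaloisObjects.nonempty_iso_of_iso_res_of_comap_ker_eq` — for `F ≅ B^temp(φ)` and `φ⁻¹(N_A) = N_A`: `F A ≅ A`
  (abc-iut-w5-d013's `ker_galoisSurjOf_of_iso_res`: `N_{F A} = φ⁻¹(N_A)`);
* `GaloisObjects.nonempty_iso_of_equivalence_of_isTopCharacteristic` — for ANY self-equivalence `E` of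
  `B^temp(Π)` (`Π` tempered, Galois-countable) and `N_A` topologically characteristic: `E A ≅ A` ([SemiAnbd]
  Prop. 3.2 in abc-iut-w5-d013's form `BTemp.exists_res_iso_of_equivalence`: `E ≅ B^temp(φ)`, `φ` an ISOMORPHISM);
* `GaloisObjects.nonempty_iso_of_connectedPart_equivalence_of_isTopCharacteristic` — the same for self-equivalences
  of the CONNECTED temperoid `B^temp(Π)⁰` (abc-iut-w5-d013's `BTemp.exists_equivalence_extension`, [SemiAnbd]
  Rmk. 3.1.5 / [FrdI] §0: `Θ⁰` extends to `B^temp(Π)`, and `ι : B^temp(Π)⁰ ⥤ B^temp(Π)` is fully faithful);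
* `BiKummerSetting.hchar_mkOfConnectedTemperoid_of_isTopCharacteristic` — **the binder `hchar` of the §4 setting
  over `B^temp(Π^tp_X)⁰`, for ALL self-equivalences `Θ`, from `IsTopCharacteristic X.Pi S.Hodot`** (the "`res γ`
  (+ twist)" shape of the row is subsumed: by Prop. 3.2 every `Θ` is of that shape); corollaries `…Quot`
  (`A_⊙ := (Π^tp_X/M, 0)`, ⟸ `IsTopCharacteristic X.Pi M`), `…Ydd` (`A_⊙^bs := Ÿ`, ⟸ `IsTopCharacteristic T.PiX
  T.PiYdd`), `hchar_mkOfThetaSettingYdd` (the Setting, ⟸ `IsTopCharacteristic Π^tp_X̲̲ Π^tp_Ÿ̲̲`), and the knit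
  `exists_thm44Hyp_mkOfConnectedTemperoid_of_isTopCharacteristic` = abc-iut-L2-t9's
  `exists_thm44Hyp_mkOfModelCanonical_treeCatVocab` with `hchar` DISCHARGED and `hopen` a theorem
  (abc-iut-L2-t4's `isOpen_Hodot_mkOfConnectedTemperoid`): residual §4-setting clause = `hshape` only; primed variant with
  `h34` (F-0711) discharged by abc-iut-L1's `FrdI.Thm34ii_holds`.
HONEST FRAMING: kernel-checked group/category theory over abc-iut-L3's temperoid vocabulary; the anabelian content
("`Π^tp_Ÿ̲̲` is characteristic", [EtTh] Prop. 2.4) stays a NAMED HYPOTHESIS; [EtTh]/[SemiAnbd] are refereed pre-IUT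
material; nothing here bears on [IUTchIII] Cor. 3.12 — no side is taken; typed ≠ proved for the genuine data.
-/

noncomputable section

open CategoryTheory Topology

namespace Literature.AnabelianGeometry.SemiGraphs

namespace GaloisObjects

open Literature.AlgebraicGeometry.Frobenioids (IsConnectedObj connectedObjects ConnectedPart)

universe u

variable {G : Type u} [Group G] [TopologicalSpace G] [IsTopologicalGroup G]

/-! ### 1. Galois objects with the same kernel are isomorphic ([SemiAnbd] Rmk. 3.1.3) -/

/-- **Two Galois objects of `B^temp(Π)` with the same kernel `Ker(Π ↠ Aut(−))` are isomorphic**: both are the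
coset object `Π/N` of the common kernel `N` — the stabiliser of their base points ([SemiAnbd] Rmk. 3.1.2/3.1.3,
abc-iut-L3's `BTemp.nonempty_quotientObj_iso_of_isConnectedObj`). [cite: MochizukiSemiAnbd2006, Rmk 3.1.3 p.34] -/
theorem nonempty_iso_of_ker_galoisSurjOf_eq (hG : IsTempered G) {A B : BTemp G} (hA : IsGaloisObj A)
    (hB : IsGaloisObj B) (h : (galoisSurjOf hG A hA).ker = (galoisSurjOf hG B hB).ker) : Nonempty (A ≅ B) := by
  obtain ⟨_, ⟨eA⟩⟩ := BTemp.nonempty_quotientObj_iso_of_isConnectedObj hG A hA.1 (galoisBase hG A hA)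
    (galoisSurjOf hG A hA).ker (fun g => mem_ker_galoisSurjOf_iff_stab hG A hA (galoisBase hG A hA) g)
  obtain ⟨_, ⟨eB⟩⟩ := BTemp.nonempty_quotientObj_iso_of_isConnectedObj hG B hB.1 (galoisBase hG B hB)
    (galoisSurjOf hG A hA).ker (fun g => by
      rw [h]; exact mem_ker_galoisSurjOf_iff_stab hG B hB (galoisBase hG B hB) g)
  exact ⟨eA.symm ≪≫ eB⟩

/-! ### 2. `F ≅ B^temp(φ)` with `φ⁻¹(N_A) = N_A` fixes the Galois object `A` up to isomorphism -/

/-- **For `F ≅ B^temp(φ)` (`φ` a continuous surjection) and a Galois object `A` with `φ⁻¹(N_A) = N_A`: `F A ≅ A`**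
— `N_{F A} = φ⁻¹(N_A)` (abc-iut-w5-d013's `ker_galoisSurjOf_of_iso_res`) and §1.
[cite: MochizukiEtTh2009, Thm 4.4 (i) p.320 (PDF p.94)] -/
theorem nonempty_iso_of_iso_res_of_comap_ker_eq (hG : IsTempered G) (φ : G →ₜ* G) (hφ : Function.Surjective φ)
    {F : BTemp G ⥤ BTemp G} (η : F ≅ BTemp.res φ) (A : BTemp G) (hA : IsGaloisObj A)
    (hker : (galoisSurjOf hG A hA).ker.comap φ.toMonoidHom = (galoisSurjOf hG A hA).ker) :
    Nonempty (F.obj A ≅ A) := by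
  have hFA : IsGaloisObj (F.obj A) := isGaloisObj_of_iso_res hG hG φ hφ η A hA
  refine nonempty_iso_of_ker_galoisSurjOf_eq hG hFA hA ?_
  rw [ker_galoisSurjOf_of_iso_res hG hG φ hφ η A hA hFA, hker]

/-! ### 3. Self-equivalences of `B^temp(Π)` ([SemiAnbd] Prop. 3.2) fix Galois objects with characteristic kernel -/

omit [IsTopologicalGroup G] in
/-- A topologically characteristic subgroup is stable under the PREIMAGE along any continuous homomorphism `φ` that
admits a continuous two-sided inverse `ψ` (`(φ, ψ)` is then an isomorphism of topological groups, and `φ⁻¹(N) =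
ψ(N) = N`). [cite: MochizukiEtTh2009, Def 3.3 p.72] -/
theorem comap_eq_of_isTopCharacteristic (φ ψ : G →ₜ* G) (hψφ : ∀ x, ψ (φ x) = x) (hφψ : ∀ y, φ (ψ y) = y)
    {N : Subgroup G} (hc : Literature.AnabelianGeometry.EtaleTheta.IsTopCharacteristic G N) :
    N.comap φ.toMonoidHom = N := by
  -- the isomorphism of topological groups `(φ, ψ)`
  let Φ : G ≃ₜ* G :=
    { toMulEquiv := { toFun := φ, invFun := ψ, left_inv := hψφ, right_inv := hφψ, map_mul' := map_mul φ }
      continuous_toFun := φ.continuous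
      continuous_invFun := ψ.continuous }
  have h := hc Φ.symm
  have e : N.comap φ.toMonoidHom = N.comap Φ.toMulEquiv.toMonoidHom := rfl
  rw [e, Subgroup.comap_equiv_eq_map_symm']
  exact h

/-- **Every self-equivalence `E` of `B^temp(Π)` (`Π` tempered, Galois-countable) maps a Galois object `A` whose
kernel `N_A` is characteristic in the topological group `Π` to an isomorph of `A`**: `E ≅ B^temp(φ)` for an
ISOMORPHISM `φ` of tempered groups ([SemiAnbd] Prop. 3.2, abc-iut-w5-d013's `BTemp.exists_res_iso_of_equivalence`),
`N_{E A} = φ⁻¹(N_A) = N_A`, and §1. [cite: MochizukiSemiAnbd2006, Prop 3.2 p.35] -/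
theorem nonempty_iso_of_equivalence_of_isTopCharacteristic [SecondCountableTopology G] (hG : IsTempered G)
    (E : BTemp G ≌ BTemp G) (A : BTemp G) (hA : IsGaloisObj A)
    (hc : Literature.AnabelianGeometry.EtaleTheta.IsTopCharacteristic G (galoisSurjOf hG A hA).ker) :
    Nonempty (E.functor.obj A ≅ A) := by
  obtain ⟨φ, ψ, hψφ, hφψ, ⟨η⟩, -⟩ := BTemp.exists_res_iso_of_equivalence hG hG E
  exact nonempty_iso_of_iso_res_of_comap_ker_eq hG φ (fun y => ⟨ψ y, hφψ y⟩) η A hA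
    (comap_eq_of_isTopCharacteristic φ ψ hψφ hφψ hc)

/-! ### 4. Self-equivalences of the CONNECTED temperoid `B^temp(Π)⁰` ([SemiAnbd] Rmk. 3.1.5, [FrdI] §0) -/

/-- **Every self-equivalence `Θ` of the connected temperoid `B^temp(Π)⁰` maps a Galois object `A` with
characteristic kernel to an isomorph of `A`**: `Θ` extends to a self-equivalence `E` of `B^temp(Π)` with
`Θ ⋙ ι ≅ ι ⋙ E` (abc-iut-w5-d013's `BTemp.exists_equivalence_extension`), §3 gives `(Θ A)^♭ ≅ E(A^♭) ≅ A^♭` in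
`B^temp(Π)`, and `ι` is fully faithful. [cite: MochizukiSemiAnbd2006, Rmk 3.1.5 p.34] -/
theorem nonempty_iso_of_connectedPart_equivalence_of_isTopCharacteristic [SecondCountableTopology G]
    (hG : IsTempered G) (Θ : ConnectedPart (BTemp G) ≌ ConnectedPart (BTemp G)) (A : ConnectedPart (BTemp G))
    (hA : IsGaloisObj A.obj)
    (hc : Literature.AnabelianGeometry.EtaleTheta.IsTopCharacteristic G (galoisSurjOf hG A.obj hA).ker) :
    Nonempty (Θ.functor.obj A ≅ A) := by
  obtain ⟨E, ⟨e⟩⟩ := BTemp.exists_equivalence_extension Θ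
  obtain ⟨i⟩ := nonempty_iso_of_equivalence_of_isTopCharacteristic hG E A.obj hA hc
  exact ⟨(connectedObjects (BTemp G)).fullyFaithfulι.preimageIso (e.app A ≪≫ i)⟩

end GaloisObjects

end Literature.AnabelianGeometry.SemiGraphs

/-! ### 5. [EtTh] §4/§5: the binder `hchar` over `B^temp(Π^tp_X)⁰` -/

namespace Literature.AnabelianGeometry.EtaleTheta

open Literature.AlgebraicGeometry.Frobenioids Literature.AnabelianGeometry.SemiGraphs
  Literature.AnabelianGeometry.SemiGraphs.GaloisObjects

universe u₀ v₀ w u u'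

/-- **Transport of characteristic subgroups along an isomorphism of topological groups `e : G ≃ₜ* G'` ACROSS
UNIVERSES** (abc-iut-w4-d034's `IsTopCharacteristic.comap_continuousMulEquiv`, verbatim proof, with `G`, `G'` in
possibly different universes — needed for `ιX : T.PiX ≃ₜ* X.Pi` of the §5 data): the preimage of a characteristic
subgroup of `G'` is characteristic in `G`. [cite: MochizukiEtTh2009, Def 3.3 p.72] -/
theorem IsTopCharacteristic.comap_continuousMulEquiv_univ {G : Type u} [Group G] [TopologicalSpace G]
    {G' : Type u'} [Group G'] [TopologicalSpace G'] {K : Subgroup G'} (hK : IsTopCharacteristic G' K) (e : G ≃ₜ* G') :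
    IsTopCharacteristic G (K.comap e.toMulEquiv.toMonoidHom) := by
  have hle : ∀ φ : G ≃ₜ* G,
      (K.comap e.toMulEquiv.toMonoidHom).map φ.toMulEquiv.toMonoidHom ≤ K.comap e.toMulEquiv.toMonoidHom := by
    rintro φ _ ⟨y, hy, rfl⟩
    change e (φ y) ∈ K
    rw [← hK (e.symm.trans (φ.trans e))]
    refine ⟨e y, hy, ?_⟩
    change (e.symm.trans (φ.trans e)) (e y) = e (φ y)
    rw [ContinuousMulEquiv.trans_apply, ContinuousMulEquiv.trans_apply, ContinuousMulEquiv.symm_apply_apply]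
  intro φ
  exact le_antisymm (hle φ) fun x hx => ⟨φ.symm x, hle φ.symm ⟨x, hx, rfl⟩, φ.apply_symm_apply x⟩

/-- **`Π^tp_X/M ∈ B^temp(Π^tp_X)⁰` is preserved by EVERY self-equivalence of `B^temp(Π^tp_X)⁰` as soon as `M` is
characteristic in the topological group `Π^tp_X`** ([SemiAnbd] Ex. 3.10: `Π^tp_X` tempered and Galois-countable) —
the object `A_⊙^bs` of abc-iut-L2-t4's `mkOfConnectedTemperoidQuot` / `…Ydd` (`connQuotObj M`).
[cite: MochizukiEtTh2009, §5 p.322–323 (PDF pp.96–97)] -/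
theorem TemperedFrobenioid.isIsomorph_connQuotObj_of_isTopCharacteristic {K : Type u₀} [Field K]
    (X : SemiGraphs.TemperedArithmeticGroup.{u₀} K) (M : OpenNormalSubgroup X.Pi)
    (hc : IsTopCharacteristic X.Pi M.toSubgroup) :
    ∀ Θ : ConnectedPart (BTemp X.Pi) ≌ ConnectedPart (BTemp X.Pi),
      IsIsomorph (Θ.functor.obj (TemperedFrobenioid.connQuotObj (X := X) M)) (TemperedFrobenioid.connQuotObj (X := X) M) := by
  haveI := X.secondCountableTopology
  have hG : SemiGraphs.IsGaloisObj (TemperedFrobenioid.connQuotObj (X := X) M).obj :=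
    isGaloisObj_of_iso_quotientObj X.isTempered _ M (Iso.refl _)
  have hker : (galoisSurjOf X.isTempered (TemperedFrobenioid.connQuotObj (X := X) M).obj hG).ker = M.toSubgroup := by
    ext g
    rw [mem_ker_galoisSurjOf_iff_stab X.isTempered _ hG ((1 : X.Pi) : X.Pi ⧸ M.toSubgroup) g]
    exact quotientObj_ρ_one_eq_iff X.isTempered M.toSubgroup M.isOpen' g
  have hc' : IsTopCharacteristic X.Pi (galoisSurjOf X.isTempered (TemperedFrobenioid.connQuotObj (X := X) M).obj hG).ker := by
    rw [hker]; exact hc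
  intro Θ
  exact nonempty_iso_of_connectedPart_equivalence_of_isTopCharacteristic X.isTempered Θ _ hG hc'

namespace BiKummerSetting

section Connected

variable {K : Type u₀} [Field K] (X : SemiGraphs.TemperedArithmeticGroup.{u₀} K) {D₀ : Type u₀} [Category.{v₀} D₀]
  {V : FrdIMonoidStub.{w}} {T₀ : RealifiedDivisorMonoids (D₀ := D₀) V}
  {VD : FrdICatStub.{u₀ + 1, u₀, w} (ConnectedPart (BTemp X.Pi))}
  (tf : TemperedFrobenioid T₀ (ConnectedPart (BTemp X.Pi)) VD) (hZ : tf.monoidType = MonoidType.Z)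
  (hP : ∀ A : (ConnectedPart (BTemp X.Pi))ᵒᵖ, IsPerfect (tf.Φ.carrier A))
  (NH : Subgroup (Field.absoluteGaloisGroup K) → tf.category → ℕ+ → Prop)

/-- **[EtTh] §5 p.322–323 "`A_⊚^bs` is characteristic — preserved by arbitrary self-equivalences of `D`", PROVED
over `D := B^temp(Π^tp_X)⁰` from "`H_⊙ ⊆ Π^tp_X` is topologically characteristic"** (the binder `hchar` of
abc-iut-L2-t9's `exists_thm44Hyp_mkOfModelCanonical_treeCatVocab`, in its `A₀.base` form, for EVERY
self-equivalence `Θ`).  `H_⊙ = Ker(Π^tp_X ↠ Aut(A_⊙^bs))` by abc-iut-L2-t4's `ker_mkOfConnectedTemperoid_galoisSurj`.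
[cite: MochizukiEtTh2009, §5 p.322–323 (PDF pp.96–97)] -/
theorem hchar_mkOfConnectedTemperoid_of_isTopCharacteristic (A₀ : tf.category)
    (hA₀ : PreFrobenioid.IsFrobeniusTrivial tf.toElem A₀) (hA₀' : SemiGraphs.IsGaloisObj A₀.base.obj)
    (hc : IsTopCharacteristic X.Pi (mkOfConnectedTemperoid X tf hZ hP NH A₀ hA₀ hA₀').Hodot) :
    ∀ Θ : ConnectedPart (BTemp X.Pi) ≌ ConnectedPart (BTemp X.Pi), IsIsomorph (Θ.functor.obj A₀.base) A₀.base := by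
  haveI := X.secondCountableTopology
  have hker : (mkOfConnectedTemperoid X tf hZ hP NH A₀ hA₀ hA₀').Hodot =
      (galoisSurjOf X.isTempered A₀.base.obj hA₀').ker :=
    ker_mkOfConnectedTemperoid_galoisSurj X tf hZ hP NH A₀ hA₀ hA₀' A₀.base hA₀'
  rw [hker] at hc
  intro Θ
  exact nonempty_iso_of_connectedPart_equivalence_of_isTopCharacteristic X.isTempered Θ A₀.base hA₀' hc

/-- The same in the `S.base.obj S.Aodot` form of abc-iut-L2-t9's `exists_thm44Hyp_self_of_characteristic` /
abc-iut-L2-t3's `Thm44Hyp.mapsAodot`. [cite: MochizukiEtTh2009, Thm 4.4 p.319 (PDF p.93)] -/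
theorem hchar_mkOfConnectedTemperoid_of_isTopCharacteristic' (A₀ : tf.category)
    (hA₀ : PreFrobenioid.IsFrobeniusTrivial tf.toElem A₀) (hA₀' : SemiGraphs.IsGaloisObj A₀.base.obj)
    (hc : IsTopCharacteristic X.Pi (mkOfConnectedTemperoid X tf hZ hP NH A₀ hA₀ hA₀').Hodot) :
    ∀ Θ : ConnectedPart (BTemp X.Pi) ≌ ConnectedPart (BTemp X.Pi),
      IsIsomorph (Θ.functor.obj ((mkOfConnectedTemperoid X tf hZ hP NH A₀ hA₀ hA₀').base.obj
        (mkOfConnectedTemperoid X tf hZ hP NH A₀ hA₀ hA₀').Aodot))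
        ((mkOfConnectedTemperoid X tf hZ hP NH A₀ hA₀ hA₀').base.obj (mkOfConnectedTemperoid X tf hZ hP NH A₀ hA₀ hA₀').Aodot) :=
  hchar_mkOfConnectedTemperoid_of_isTopCharacteristic X tf hZ hP NH A₀ hA₀ hA₀' hc

/-- **`A_⊙ := (Π^tp_X/M, 0)` (abc-iut-L2-t4's `mkOfConnectedTemperoidQuot`): `hchar` ⟸ "`M` is characteristic in the
topological group `Π^tp_X`"** (`H_⊙ = M`, `Hodot_mkOfConnectedTemperoidQuot`). [cite: MochizukiEtTh2009, §5 p.322–323 (PDF pp.96–97)] -/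
theorem hchar_mkOfConnectedTemperoidQuot_of_isTopCharacteristic (M : OpenNormalSubgroup X.Pi)
    (hc : IsTopCharacteristic X.Pi M.toSubgroup) :
    ∀ Θ : ConnectedPart (BTemp X.Pi) ≌ ConnectedPart (BTemp X.Pi),
      IsIsomorph (Θ.functor.obj ((mkOfConnectedTemperoidQuot X tf hZ hP NH M).base.obj
        (mkOfConnectedTemperoidQuot X tf hZ hP NH M).Aodot))
        ((mkOfConnectedTemperoidQuot X tf hZ hP NH M).base.obj (mkOfConnectedTemperoidQuot X tf hZ hP NH M).Aodot) :=
  TemperedFrobenioid.isIsomorph_connQuotObj_of_isTopCharacteristic X M hc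

/-- **The §5 choice `A_⊙^bs := Ÿ` (`A_⊙ := (Π^tp_X/ιX(Π^tp_Ÿ), 0)`, abc-iut-L2-t4's `mkOfConnectedTemperoidYdd`): `hchar` ⟸
"`Π^tp_Ÿ ⊆ Π^tp_X` is characteristic in the topological group"** (transported along the identification
`ιX : T.PiX ≃ₜ* X.Pi` by abc-iut-w4-d034's `IsTopCharacteristic.comap_continuousMulEquiv`; `H_⊙ = ιX(Π^tp_Ÿ)` by
`mem_Hodot_mkOfConnectedTemperoidYdd_iff`). [cite: MochizukiEtTh2009, §5 p.322–323 (PDF pp.96–97)] -/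
theorem hchar_mkOfConnectedTemperoidYdd_of_isTopCharacteristic {N : ℕ+} (T : ThetaEnvData.{max u₀ w} N)
    (ιX : T.PiX ≃ₜ* X.Pi) (hc : IsTopCharacteristic T.PiX T.PiYdd) :
    ∀ Θ : ConnectedPart (BTemp X.Pi) ≌ ConnectedPart (BTemp X.Pi),
      IsIsomorph (Θ.functor.obj ((mkOfConnectedTemperoidYdd X tf hZ hP NH T ιX).base.obj
        (mkOfConnectedTemperoidYdd X tf hZ hP NH T ιX).Aodot))
        ((mkOfConnectedTemperoidYdd X tf hZ hP NH T ιX).base.obj (mkOfConnectedTemperoidYdd X tf hZ hP NH T ιX).Aodot) := by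
  -- `H_⊙ = ιX(Π^tp_Ÿ) = (ιX⁻¹)⁻¹(Π^tp_Ÿ)` is characteristic in `Π^tp_X`
  have hH : (mkOfConnectedTemperoidYdd X tf hZ hP NH T ιX).Hodot = T.PiYdd.comap ιX.symm.toMulEquiv.toMonoidHom := by
    ext g
    rw [mem_Hodot_mkOfConnectedTemperoidYdd_iff, Subgroup.mem_comap]
    rfl
  have hc' : IsTopCharacteristic X.Pi (mkOfConnectedTemperoidYdd X tf hZ hP NH T ιX).Hodot := by
    rw [hH]
    exact hc.comap_continuousMulEquiv_univ ιX.symm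
  intro Θ
  exact hchar_mkOfConnectedTemperoid_of_isTopCharacteristic X tf hZ hP NH
    (mkOfConnectedTemperoidYdd X tf hZ hP NH T ιX).Aodot (mkOfConnectedTemperoidYdd X tf hZ hP NH T ιX).isFrobeniusTrivial_Aodot
    (mkOfConnectedTemperoidYdd X tf hZ hP NH T ιX).isGalois_Aodot hc' Θ

end Connected

/-! ### 6. The knit: `Thm44Hyp S S` over `B^temp(Π^tp_X)⁰` with `hchar` AND `hopen` discharged -/

section TreeVocab

variable {K : Type u₀} [Field K] (X : SemiGraphs.TemperedArithmeticGroup.{u₀} K) {D₀ : Type u₀} [Category.{v₀} D₀]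
  {T₀ : RealifiedDivisorMonoids (D₀ := D₀) treeMonoidVocab.{w}}
  {IsRational IsStrictlyRational : ((ConnectedPart (BTemp X.Pi))ᵒᵖ ⥤ CommMonCat.{w}) → Prop}
  (C : TemperedFrobenioid T₀ (ConnectedPart (BTemp X.Pi)) (treeCatVocab (ConnectedPart (BTemp X.Pi)) IsRational IsStrictlyRational))
  (hZ : C.monoidType = MonoidType.Z) (hP : ∀ A : (ConnectedPart (BTemp X.Pi))ᵒᵖ, IsPerfect (C.Φ.carrier A))
  (NH : Subgroup (Field.absoluteGaloisGroup K) → C.category → ℕ+ → Prop) (A₀ : C.category)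
  (hA₀ : PreFrobenioid.IsFrobeniusTrivial C.toElem A₀) (hA₀' : SemiGraphs.IsGaloisObj A₀.base.obj)

/-- **abc-iut-L2-t3's `Thm44Hyp S S` at the §4 setting over the GENUINE connected base `B^temp(Π^tp_X)⁰`** (abc-iut-L2-t9's
`exists_thm44Hyp_mkOfModelCanonical_treeCatVocab` at `mkOfConnectedTemperoid`), for every self-equivalence `Ψ`, with the
§4-setting clauses **`hchar` (this file) and `hopen` (abc-iut-L2-t4's `isOpen_Hodot_mkOfConnectedTemperoid`) DISCHARGED**, and
the base hypotheses "`D` slim" ([SemiAnbd] Rmk. 3.4.1, `TemperedArithmeticGroup.isSlim_connectedPart`) / "`D` of FSMFF-type"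
([FrdII] Ex. 1.3, `QuasiTemperoid.BTempConnected.connectedPart_isOfFSMFFType`) THEOREMS: residual = {`h34` (F-0711), `hBmon`,
`hnd` (Thm. 3.7 (i) input), `hshape` ("`D = D₀[𝒟]`")} and the ONE anabelian clause `hc : IsTopCharacteristic X.Pi H_⊙`
([EtTh] Prop. 2.4 currency). [cite: MochizukiEtTh2009, Thm 4.4 p.319 (PDF p.93); §5 p.322–323 (PDF pp.96–97)] -/
theorem exists_thm44Hyp_mkOfConnectedTemperoid_of_isTopCharacteristic (h34 : FrdI.Thm34ii.{w, u₀, max u₀ w, u₀ + 1, max (u₀ + 1) w})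
    (hBmon : IsMonoidOn C.ratFnFunctor)
    (hnd : ∀ (A : (ConnectedPart (BTemp X.Pi))ᵒᵖ) (f : A ⟶ A), treeMonoidVocab.{w}.IsNonDilating (C.Φ.carrier A) (C.Φ.pull f))
    (hshape : C.base.Full ∧ C.base.Faithful ∧
      ∃ 𝒟 : D₀, ∀ Y : D₀, (∃ A : ConnectedPart (BTemp X.Pi), Nonempty (C.base.obj A ≅ Y)) ↔ Nonempty (Y ⟶ 𝒟))
    (hc : IsTopCharacteristic X.Pi (mkOfConnectedTemperoid X C hZ hP NH A₀ hA₀ hA₀').Hodot)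
    (Ψ : C.category ≌ C.category) :
    ∃ hh : Thm44Hyp (mkOfConnectedTemperoid X C hZ hP NH A₀ hA₀ hA₀') (mkOfConnectedTemperoid X C hZ hP NH A₀ hA₀ hA₀'),
      hh.Ψ = Ψ :=
  exists_thm44Hyp_mkOfModelCanonical_treeCatVocab X C hZ hP _ _ _ NH A₀ hA₀ hA₀' h34 hBmon
    QuasiTemperoid.BTempConnected.connectedPart_isOfFSMFFType hnd (TemperedArithmeticGroup.isSlim_connectedPart X) hshape
    (isOpen_Hodot_mkOfConnectedTemperoid X C hZ hP NH A₀ hA₀ hA₀')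
    (hchar_mkOfConnectedTemperoid_of_isTopCharacteristic X C hZ hP NH A₀ hA₀ hA₀' hc) Ψ

/-- **The same with [FrdI] Thm. 3.4 (ii) (F-0711) DISCHARGED by abc-iut-L1's `FrdI.Thm34ii_holds`**: abc-iut-L2-t3's
`Thm44Hyp S S` over `B^temp(Π^tp_X)⁰` for every self-equivalence `Ψ`, residual = {`hBmon` ([FrdI] Thm. 5.2 preamble), `hnd`
(Thm. 3.7 (i) "`Φ` non-dilating"), `hshape` ("`D = D₀[𝒟]`")} and the ONE anabelian clause `hc : IsTopCharacteristic X.Pi H_⊙`.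
[cite: MochizukiEtTh2009, Thm 4.4 p.319 (PDF p.93); §5 p.322–323 (PDF pp.96–97)] -/
theorem exists_thm44Hyp_mkOfConnectedTemperoid_of_isTopCharacteristic' (hBmon : IsMonoidOn C.ratFnFunctor)
    (hnd : ∀ (A : (ConnectedPart (BTemp X.Pi))ᵒᵖ) (f : A ⟶ A), treeMonoidVocab.{w}.IsNonDilating (C.Φ.carrier A) (C.Φ.pull f))
    (hshape : C.base.Full ∧ C.base.Faithful ∧
      ∃ 𝒟 : D₀, ∀ Y : D₀, (∃ A : ConnectedPart (BTemp X.Pi), Nonempty (C.base.obj A ≅ Y)) ↔ Nonempty (Y ⟶ 𝒟))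
    (hc : IsTopCharacteristic X.Pi (mkOfConnectedTemperoid X C hZ hP NH A₀ hA₀ hA₀').Hodot)
    (Ψ : C.category ≌ C.category) :
    ∃ hh : Thm44Hyp (mkOfConnectedTemperoid X C hZ hP NH A₀ hA₀ hA₀') (mkOfConnectedTemperoid X C hZ hP NH A₀ hA₀ hA₀'),
      hh.Ψ = Ψ :=
  exists_thm44Hyp_mkOfConnectedTemperoid_of_isTopCharacteristic X C hZ hP NH A₀ hA₀ hA₀' FrdI.Thm34ii_holds hBmon hnd
    hshape hc Ψ

end TreeVocab

section Setting

variable {p : ℕ} [Fact p.Prime] {D : ThetaSetting p} {E : D.EtaleThetaData} {l : ℕ} (C : E.DoubleUnderline l)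
  (e : D.toTemperedCurve.GroupLevelData) {N : ℕ+} (μ : D.CyclotomeMod l N) (hC : D.Compat) (hS : D.Sec2Hyps)
  {D₀ : Type} [Category.{v₀} D₀] {V : FrdIMonoidStub.{0}} {T₀ : RealifiedDivisorMonoids (D₀ := D₀) V}
  {VD : FrdICatStub.{1, 0, 0} (ConnectedPart (BTemp (C.temperedArithmeticGroup e).Pi))}
  (tf : TemperedFrobenioid T₀ (ConnectedPart (BTemp (C.temperedArithmeticGroup e).Pi)) VD) (hZ : tf.monoidType = MonoidType.Z)
  (hP : ∀ A : (ConnectedPart (BTemp (C.temperedArithmeticGroup e).Pi))ᵒᵖ, IsPerfect (tf.Φ.carrier A))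
  (NH : Subgroup (Field.absoluteGaloisGroup D.K) → tf.category → ℕ+ → Prop)

/-- **THE SETTING (`A_⊙^bs := Ÿ̲̲` over `B^temp(Π^tp_X̲̲)⁰`, abc-iut-L2-t4's `mkOfThetaSettingYdd`): `A_⊚^bs` is preserved by EVERY
self-equivalence of `D` as soon as "every topological automorphism of `Π^tp_X̲̲` stabilises `Π^tp_Ÿ̲̲`"** — `hc :
IsTopCharacteristic Π^tp_X̲̲ Π^tp_Ÿ̲̲` with `Π^tp_Ÿ̲̲ = Π^tp_Ÿ ∩ Π^tp_X̲̲ = H_⊙` (abc-iut-L2-t4's `Hodot_mkOfThetaSettingYdd`), i.e. the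
[EtTh] Prop. 2.4 `Ÿ`-clause in abc-iut-w4-d034's currency = abc-iut-L6-t1's (H1) `PiYddCharacteristic` (a hypothesis BY NAME;
`C.GtpYdduu ∩ Π^tp_X̲̲ = Π^tp_Ÿ ∩ Π^tp_X̲̲`, `BadPlaceSettingOfDoubleUnderline.ofDoubleUnderline_refYdd_comap`).
[cite: MochizukiEtTh2009, §5 p.322–323 (PDF pp.96–97); Prop 2.4 p.38] -/
theorem hchar_mkOfThetaSettingYdd_of_isTopCharacteristic (hc : IsTopCharacteristic C.Huu (D.GtpYdd.subgroupOf C.Huu)) :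
    ∀ Θ : ConnectedPart (BTemp (C.temperedArithmeticGroup e).Pi) ≌ ConnectedPart (BTemp (C.temperedArithmeticGroup e).Pi),
      IsIsomorph (Θ.functor.obj ((mkOfThetaSettingYdd C e μ hC hS tf hZ hP NH).base.obj
        (mkOfThetaSettingYdd C e μ hC hS tf hZ hP NH).Aodot))
        ((mkOfThetaSettingYdd C e μ hC hS tf hZ hP NH).base.obj (mkOfThetaSettingYdd C e μ hC hS tf hZ hP NH).Aodot) :=
  hchar_mkOfConnectedTemperoidYdd_of_isTopCharacteristic (C.temperedArithmeticGroup e) tf hZ hP NH (C.thetaEnvData μ hC hS)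
    (ContinuousMulEquiv.refl _) hc

end Setting

end BiKummerSetting

end Literature.AnabelianGeometry.EtaleTheta

end
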